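import Summits.HodgeConjecture.HodgeConjecture.Theorems.Ring2WeilCoverageCMFieldRationalPlacesToolkit
import HarnessLib

/-!
# Ring 2 — Weil-family coverage, CM-field rows: RATIONAL classes are CONSTANT ON THE FIBRES of `Spec 𝓞_F → Spec ℤ`
  — which rows `W_{2k}.E.T` of the census tables can have a rational member (WEIL-FAMILY-COVERAGE «## b03»,
  cell (xxi′)(a), part 33)

research route conditional on HC_CM; not a corollary; Q11.4-sentence-2 already refuted in dim ≥ 3.

The rows of the census table of a quartic CM field `E = F(√θ)` over Deligne's carrier `R` (`F = ℚ[S]/(R) = ℚ(θ)`) are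
the classes `δ ∈ F^×/Nm_{E/F}(E^×) = cmNormResidueGroup R`, labelled by the finite even sets `T(δ) = badPlaces δ θ` of
places of `F` where `(δ, θ)_𝔭 = -1` (parts 1–11: `[q] = [q'] ⟺ T(q) = T(q')`) [cite: Deligne1982HodgeCycles, §4 (1),
Prop. 4.1, Cor. 4.2].  A row has a RATIONAL member iff `T = T(c)` for some `c ∈ ℚ^×`; the tables of §b03.5 / §b03.29
print «least rational `n`: –» on most `|T| = 2` rows.  This file proves the structural reason, for every carrier:

* §86 (any carrier `R`) **SATURATION**: at two places `v, v' ∤ 2θ` over the same rational prime `ℓ` with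
  `e(v|ℓ) = e(v'|ℓ)` at which `θ` is simultaneously a square or a non-square mod `v`, `v'`:
  `v ∈ T(c) ⟺ v' ∈ T(c)` for EVERY `c ∈ ℚ^×` — by the closed form `v ∈ T(c) ⟺ θ non-square mod v ∧ ord_v c odd`
  (O'Meara 63:11a, part 11) and `|c|_v = |c|_ℓ^{e(v|ℓ)}` (part 32); **EXCLUSION**: a place `v ∤ 2θ` with EVEN `e(v|ℓ)`
  lies in no `T(c)`.  Both also after a square-class change `θ = c₁²·b` (part 6)
  [cite: Omeara1963, §63B Cor. 63:11a and Example 63:12].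
* §87 ROW COROLLARIES: a class `δ` whose `T(δ)` contains `v` but not its partner `v'` («lonely place»), or contains a
  place `v ∤ 2θ` of even ramification over `ℚ`, differs from `[c]` for EVERY `c ∈ ℚ^×`: the row `W_{2k}.E.T(δ)` has no
  rational — a fortiori no integer and no split — member (the certificate of parts VII–VIII `…IrrationalRows*` by norm
  parity, now from the local labels and for every carrier).
* §88 THE TABLE THEOREMS for the quadratic carriers `R = S² + pS + q` (`F` real quadratic):
  (A) `E = F(√b₀)` BIQUADRATIC (`θ = c₁²·b₀`, `b₀ ∈ ℤ`): for every odd prime `ℓ ∤ b₀` and ALL places `v, v' ∋ ℓ`: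
  `v ∈ T(c) ⟺ v' ∈ T(c)` (two distinct places over `ℓ` have `e = 1` and residue field `𝔽_ℓ`, part 32, in which `b₀` is a
  square or not simultaneously); (B) `E/ℚ` CYCLIC (`q = s₀²` in `𝓞_F`): the same for every odd prime `ℓ ∤ q` (the
  residues of `θ` at `v, v'` are the two roots of `R̄`, of product `q̄ = s̄₀²`, part 32); (C) a place `v ∋ ℓ` over an odd
  prime RAMIFIED in `F` (`(ℓ, π)² = (ℓ)`) with `v ∤ b` lies in no `T(c)`.  PLACE-NAME-FREE ROW FORM: under (A)/(B),
  `T(c) ≠ {v, w}` whenever `v ≠ v'` lie over such an `ℓ` and `w ≠ v'`; under (C), `T(c) ≠ {v, w}` for every `w` — so a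
  `|T| = 2` row `{v, w}` CONTAINING one of two places over such a split odd prime has a rational member ONLY IF it is
  the full fibre `{v, v̄}`.  For the fifteen BIQUADRATIC tables (with parts 38–45: inert radicand, ramified and dyadic
  places lie in no `T(c)`, `c > 0`) this makes every other `|T| = 2` row «–» for EVERY positive rational, not only in
  the printed box (§b03.5 / §b03.29: `n ≤ 400`).  For the five CYCLIC tables rows made of `Gal(F/ℚ)`-FIXED places DO
  carry rationals — the ramified place of `F` and the inert non-norm primes: `T(2) = {(2), (√5)}` (conductors 5, 40,
  60), `T(3) = {(√2), (3)}` (conductors 16, 48), `T(399) = {(3), (19)}` (conductor 16) —, see parts 46–52 for their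
  complete description (referee finding A-207.1, gen 207/210).

No new definition, no named fact, no sorry; nothing about the Hodge conjecture is asserted.
-/

noncomputable section

set_option linter.dupNamespace false

open Polynomial NumberField IsDedekindDomain

namespace Summit.HodgeConjecture.HodgeConjecture.Ring2.WeilCoverageCM

open Literature.AlgebraicGeometry.Deligne1982
open Literature.AlgebraicGeometry.HodgeTheory (splitDiscriminantClassCM)
open Literature.NumberTheory.QuadraticForms

variable {R : Polynomial ℤ} [Fact (Irreducible (cmPolyQ R))] [Fact (Irreducible (realPolyQ R))]

/-! ### §86 Saturation over a rational prime and exclusion at evenly ramified places — every carrier -/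

omit [Fact (Irreducible (cmPolyQ R))] in
/-- **SATURATION OF RATIONAL CLASSES**: let `v, v'` be finite places of `F` over the same rational prime `ℓ` with the
same ramification index, both prime to `2θ`, at which `θ` is a square mod `v` iff it is a square mod `v'`. Then for
EVERY `c ∈ ℚ^×`: `v ∈ T(c) ⟺ v' ∈ T(c)` (`v ∈ T(c) ⟺ θ` non-square mod `v ∧ ord_v c` odd, and `|c|_v = |c|_{v'}`).
[cite: Omeara1963, §63B Cor. 63:11a and Example 63:12] [cite: Deligne1982HodgeCycles, §4 (1)] -/
theorem inl_mem_badPlaces_ratCast_iff_of_liesOver {θₒ : 𝓞 (realField R)}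
    (hθ : (θₒ : realField R) = AdjoinRoot.root (realPolyQ R)) {ℓ : ℕ} (hℓ : ℓ.Prime)
    (v v' : HeightOneSpectrum (𝓞 (realField R)))
    [v.asIdeal.LiesOver (Ideal.span {(ℓ : ℤ)})] [v'.asIdeal.LiesOver (Ideal.span {(ℓ : ℤ)})]
    (he : (Ideal.span {(ℓ : ℤ)}).ramificationIdx' v.asIdeal = (Ideal.span {(ℓ : ℤ)}).ramificationIdx' v'.asIdeal)
    (h2 : (2 : 𝓞 (realField R)) ∉ v.asIdeal) (h2' : (2 : 𝓞 (realField R)) ∉ v'.asIdeal)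
    (hθv : θₒ ∉ v.asIdeal) (hθv' : θₒ ∉ v'.asIdeal)
    (hsymm : IsSquare (Ideal.Quotient.mk v.asIdeal θₒ) ↔ IsSquare (Ideal.Quotient.mk v'.asIdeal θₒ))
    {c : ℚ} (hc : c ≠ 0) :
    Sum.inl v ∈ badPlaces (c : realField R) (AdjoinRoot.root (realPolyQ R)) ↔
      Sum.inl v' ∈ badPlaces (c : realField R) (AdjoinRoot.root (realPolyQ R)) := by
  have hc' : (c : realField R) ≠ 0 := by exact_mod_cast hc
  rw [mem_badPlaces_iff, placeSymbol_inl, hilbertSymbol_adicCompletion_root_eq_neg_one_iff hθ v h2 hθv hc',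
    mem_badPlaces_iff, placeSymbol_inl, hilbertSymbol_adicCompletion_root_eq_neg_one_iff hθ v' h2' hθv' hc',
    valuation_ratCast_eq_of_ramificationIdx_eq hℓ v v' he c, hsymm]

/-- **SATURATION, after a square-class change `θ = c₁²·b`** (`b ∈ 𝓞_F` a unit at `v, v' ∤ 2`, a square mod `v` iff
mod `v'`): `v ∈ T(c) ⟺ v' ∈ T(c)` for every `c ∈ ℚ^×`. [cite: Omeara1963, §63B Cor. 63:11a and Example 63:12] -/
theorem inl_mem_badPlaces_ratCast_iff_of_liesOver_of_eq_sq_mul {c₁ : realField R} {b : 𝓞 (realField R)}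
    (hfac : AdjoinRoot.root (realPolyQ R) = c₁ ^ 2 * (b : realField R)) {ℓ : ℕ} (hℓ : ℓ.Prime)
    (v v' : HeightOneSpectrum (𝓞 (realField R)))
    [v.asIdeal.LiesOver (Ideal.span {(ℓ : ℤ)})] [v'.asIdeal.LiesOver (Ideal.span {(ℓ : ℤ)})]
    (he : (Ideal.span {(ℓ : ℤ)}).ramificationIdx' v.asIdeal = (Ideal.span {(ℓ : ℤ)}).ramificationIdx' v'.asIdeal)
    (h2 : (2 : 𝓞 (realField R)) ∉ v.asIdeal) (h2' : (2 : 𝓞 (realField R)) ∉ v'.asIdeal)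
    (hbv : b ∉ v.asIdeal) (hbv' : b ∉ v'.asIdeal)
    (hsymm : IsSquare (Ideal.Quotient.mk v.asIdeal b) ↔ IsSquare (Ideal.Quotient.mk v'.asIdeal b))
    {c : ℚ} (hc : c ≠ 0) :
    Sum.inl v ∈ badPlaces (c : realField R) (AdjoinRoot.root (realPolyQ R)) ↔
      Sum.inl v' ∈ badPlaces (c : realField R) (AdjoinRoot.root (realPolyQ R)) := by
  have hc' : (c : realField R) ≠ 0 := by exact_mod_cast hc
  rw [mem_badPlaces_iff, placeSymbol_inl,
    hilbertSymbol_adicCompletion_root_eq_neg_one_iff_of_eq_sq_mul_of_notMem hfac v h2 hbv hc',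
    mem_badPlaces_iff, placeSymbol_inl,
    hilbertSymbol_adicCompletion_root_eq_neg_one_iff_of_eq_sq_mul_of_notMem hfac v' h2' hbv' hc',
    valuation_ratCast_eq_of_ramificationIdx_eq hℓ v v' he c, hsymm]

omit [Fact (Irreducible (cmPolyQ R))] in
/-- **EXCLUSION AT EVENLY RAMIFIED PLACES**: a finite place `v ∤ 2θ` with EVEN ramification index over `ℚ` (e.g. an odd
prime ramified in a quadratic `F`) lies in NO `T(c)`, `c ∈ ℚ^×` (`ord_v c = e·ord_ℓ c` is even).
[cite: Omeara1963, §63B Cor. 63:11a and Example 63:12] -/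
theorem inl_notMem_badPlaces_ratCast_of_even_ramificationIdx {θₒ : 𝓞 (realField R)}
    (hθ : (θₒ : realField R) = AdjoinRoot.root (realPolyQ R)) {ℓ : ℕ} (hℓ : ℓ.Prime)
    (v : HeightOneSpectrum (𝓞 (realField R))) [v.asIdeal.LiesOver (Ideal.span {(ℓ : ℤ)})]
    (he : Even ((Ideal.span {(ℓ : ℤ)}).ramificationIdx' v.asIdeal))
    (h2 : (2 : 𝓞 (realField R)) ∉ v.asIdeal) (hθv : θₒ ∉ v.asIdeal) {c : ℚ} (hc : c ≠ 0) :
    Sum.inl v ∉ badPlaces (c : realField R) (AdjoinRoot.root (realPolyQ R)) := by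
  have hc' : (c : realField R) ≠ 0 := by exact_mod_cast hc
  rw [mem_badPlaces_iff, placeSymbol_inl, hilbertSymbol_adicCompletion_root_eq_neg_one_iff hθ v h2 hθv hc', not_and]
  exact fun _ ↦ Int.not_odd_iff_even.2 (even_log_valuation_ratCast_of_even_ramificationIdx hℓ v he hc)

/-- **EXCLUSION AT EVENLY RAMIFIED PLACES, after a square-class change `θ = c₁²·b`** (`b` a `v`-unit, `v ∤ 2`).
[cite: Omeara1963, §63B Cor. 63:11a and Example 63:12] -/
theorem inl_notMem_badPlaces_ratCast_of_even_ramificationIdx_of_eq_sq_mul {c₁ : realField R}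
    {b : 𝓞 (realField R)} (hfac : AdjoinRoot.root (realPolyQ R) = c₁ ^ 2 * (b : realField R)) {ℓ : ℕ} (hℓ : ℓ.Prime)
    (v : HeightOneSpectrum (𝓞 (realField R))) [v.asIdeal.LiesOver (Ideal.span {(ℓ : ℤ)})]
    (he : Even ((Ideal.span {(ℓ : ℤ)}).ramificationIdx' v.asIdeal))
    (h2 : (2 : 𝓞 (realField R)) ∉ v.asIdeal) (hbv : b ∉ v.asIdeal) {c : ℚ} (hc : c ≠ 0) :
    Sum.inl v ∉ badPlaces (c : realField R) (AdjoinRoot.root (realPolyQ R)) := by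
  have hc' : (c : realField R) ≠ 0 := by exact_mod_cast hc
  rw [mem_badPlaces_iff, placeSymbol_inl,
    hilbertSymbol_adicCompletion_root_eq_neg_one_iff_of_eq_sq_mul_of_notMem hfac v h2 hbv hc', not_and]
  exact fun _ ↦ Int.not_odd_iff_even.2 (even_log_valuation_ratCast_of_even_ramificationIdx hℓ v he hc)

/-! ### §87 Row corollaries: lonely places and evenly ramified places certify «no rational member» -/

/-- **A LONELY PLACE**: if `T(δ)` contains `v` but not `v'` (`v, v'` as in the saturation theorem), then
`[δ] ≠ [c]` in `F^×/Nm_{E/F}(E^×)` for EVERY `c ∈ ℚ^×` — the row `W_{2k}.E.T(δ)` has no rational member (no integer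
member, not the split row). [cite: Deligne1982HodgeCycles, §4 (1) and Cor. 4.2] -/
theorem mk_ne_mk_ratCast_of_lonely_place {θₒ : 𝓞 (realField R)}
    (hθ : (θₒ : realField R) = AdjoinRoot.root (realPolyQ R)) {ℓ : ℕ} (hℓ : ℓ.Prime)
    (v v' : HeightOneSpectrum (𝓞 (realField R)))
    [v.asIdeal.LiesOver (Ideal.span {(ℓ : ℤ)})] [v'.asIdeal.LiesOver (Ideal.span {(ℓ : ℤ)})]
    (he : (Ideal.span {(ℓ : ℤ)}).ramificationIdx' v.asIdeal = (Ideal.span {(ℓ : ℤ)}).ramificationIdx' v'.asIdeal)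
    (h2 : (2 : 𝓞 (realField R)) ∉ v.asIdeal) (h2' : (2 : 𝓞 (realField R)) ∉ v'.asIdeal)
    (hθv : θₒ ∉ v.asIdeal) (hθv' : θₒ ∉ v'.asIdeal)
    (hsymm : IsSquare (Ideal.Quotient.mk v.asIdeal θₒ) ↔ IsSquare (Ideal.Quotient.mk v'.asIdeal θₒ))
    (δ : (realField R)ˣ) (hδv : Sum.inl v ∈ badPlaces (δ : realField R) (AdjoinRoot.root (realPolyQ R)))
    (hδv' : Sum.inl v' ∉ badPlaces (δ : realField R) (AdjoinRoot.root (realPolyQ R)))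
    (c : ℚ) (γ : (realField R)ˣ) (hγ : (γ : realField R) = (c : realField R)) :
    (QuotientGroup.mk δ : cmNormResidueGroup R) ≠ QuotientGroup.mk γ := by
  intro h
  have hc : c ≠ 0 := by
    rintro rfl
    exact γ.ne_zero (by rw [hγ, Rat.cast_zero])
  rw [mk_eq_mk_iff_badPlaces_eq, hγ] at h
  rw [h] at hδv hδv'
  exact hδv' ((inl_mem_badPlaces_ratCast_iff_of_liesOver hθ hℓ v v' he h2 h2' hθv hθv' hsymm hc).1 hδv)

/-- **A LONELY PLACE, after a square-class change `θ = c₁²·b`.** [cite: Deligne1982HodgeCycles, §4 (1) and Cor. 4.2] -/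
theorem mk_ne_mk_ratCast_of_lonely_place_of_eq_sq_mul {c₁ : realField R} {b : 𝓞 (realField R)}
    (hfac : AdjoinRoot.root (realPolyQ R) = c₁ ^ 2 * (b : realField R)) {ℓ : ℕ} (hℓ : ℓ.Prime)
    (v v' : HeightOneSpectrum (𝓞 (realField R)))
    [v.asIdeal.LiesOver (Ideal.span {(ℓ : ℤ)})] [v'.asIdeal.LiesOver (Ideal.span {(ℓ : ℤ)})]
    (he : (Ideal.span {(ℓ : ℤ)}).ramificationIdx' v.asIdeal = (Ideal.span {(ℓ : ℤ)}).ramificationIdx' v'.asIdeal)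
    (h2 : (2 : 𝓞 (realField R)) ∉ v.asIdeal) (h2' : (2 : 𝓞 (realField R)) ∉ v'.asIdeal)
    (hbv : b ∉ v.asIdeal) (hbv' : b ∉ v'.asIdeal)
    (hsymm : IsSquare (Ideal.Quotient.mk v.asIdeal b) ↔ IsSquare (Ideal.Quotient.mk v'.asIdeal b))
    (δ : (realField R)ˣ) (hδv : Sum.inl v ∈ badPlaces (δ : realField R) (AdjoinRoot.root (realPolyQ R)))
    (hδv' : Sum.inl v' ∉ badPlaces (δ : realField R) (AdjoinRoot.root (realPolyQ R)))
    (c : ℚ) (γ : (realField R)ˣ) (hγ : (γ : realField R) = (c : realField R)) :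
    (QuotientGroup.mk δ : cmNormResidueGroup R) ≠ QuotientGroup.mk γ := by
  intro h
  have hc : c ≠ 0 := by
    rintro rfl
    exact γ.ne_zero (by rw [hγ, Rat.cast_zero])
  rw [mk_eq_mk_iff_badPlaces_eq, hγ] at h
  rw [h] at hδv hδv'
  exact hδv' ((inl_mem_badPlaces_ratCast_iff_of_liesOver_of_eq_sq_mul hfac hℓ v v' he h2 h2' hbv hbv' hsymm hc).1 hδv)

/-- **AN EVENLY RAMIFIED PLACE in `T(δ)`** (`v ∤ 2θ`, `e(v|ℓ)` even) ⟹ `[δ] ≠ [c]` for every `c ∈ ℚ^×`.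
[cite: Deligne1982HodgeCycles, §4 (1) and Cor. 4.2] -/
theorem mk_ne_mk_ratCast_of_even_ramificationIdx {θₒ : 𝓞 (realField R)}
    (hθ : (θₒ : realField R) = AdjoinRoot.root (realPolyQ R)) {ℓ : ℕ} (hℓ : ℓ.Prime)
    (v : HeightOneSpectrum (𝓞 (realField R))) [v.asIdeal.LiesOver (Ideal.span {(ℓ : ℤ)})]
    (he : Even ((Ideal.span {(ℓ : ℤ)}).ramificationIdx' v.asIdeal))
    (h2 : (2 : 𝓞 (realField R)) ∉ v.asIdeal) (hθv : θₒ ∉ v.asIdeal)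
    (δ : (realField R)ˣ) (hδv : Sum.inl v ∈ badPlaces (δ : realField R) (AdjoinRoot.root (realPolyQ R)))
    (c : ℚ) (γ : (realField R)ˣ) (hγ : (γ : realField R) = (c : realField R)) :
    (QuotientGroup.mk δ : cmNormResidueGroup R) ≠ QuotientGroup.mk γ := by
  intro h
  have hc : c ≠ 0 := by
    rintro rfl
    exact γ.ne_zero (by rw [hγ, Rat.cast_zero])
  rw [mk_eq_mk_iff_badPlaces_eq, hγ] at h
  rw [h] at hδv
  exact inl_notMem_badPlaces_ratCast_of_even_ramificationIdx hθ hℓ v he h2 hθv hc hδv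

/-- **AN EVENLY RAMIFIED PLACE in `T(δ)`, after a square-class change `θ = c₁²·b`.**
[cite: Deligne1982HodgeCycles, §4 (1) and Cor. 4.2] -/
theorem mk_ne_mk_ratCast_of_even_ramificationIdx_of_eq_sq_mul {c₁ : realField R} {b : 𝓞 (realField R)}
    (hfac : AdjoinRoot.root (realPolyQ R) = c₁ ^ 2 * (b : realField R)) {ℓ : ℕ} (hℓ : ℓ.Prime)
    (v : HeightOneSpectrum (𝓞 (realField R))) [v.asIdeal.LiesOver (Ideal.span {(ℓ : ℤ)})]
    (he : Even ((Ideal.span {(ℓ : ℤ)}).ramificationIdx' v.asIdeal))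
    (h2 : (2 : 𝓞 (realField R)) ∉ v.asIdeal) (hbv : b ∉ v.asIdeal)
    (δ : (realField R)ˣ) (hδv : Sum.inl v ∈ badPlaces (δ : realField R) (AdjoinRoot.root (realPolyQ R)))
    (c : ℚ) (γ : (realField R)ˣ) (hγ : (γ : realField R) = (c : realField R)) :
    (QuotientGroup.mk δ : cmNormResidueGroup R) ≠ QuotientGroup.mk γ := by
  intro h
  have hc : c ≠ 0 := by
    rintro rfl
    exact γ.ne_zero (by rw [hγ, Rat.cast_zero])
  rw [mk_eq_mk_iff_badPlaces_eq, hγ] at h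
  rw [h] at hδv
  exact inl_notMem_badPlaces_ratCast_of_even_ramificationIdx_of_eq_sq_mul hfac hℓ v he h2 hbv hc hδv

/-! ### §88 THE TABLE THEOREMS for quadratic carriers `R = S² + pS + q` -/

/-- For a prime `ℓ` and `n = 1` or `n` a prime different from `ℓ`: `ℓ ∤ -n` (the radicands `b₀ = -1, -2, -3, -5`).
[folklore] -/
theorem not_natCast_dvd_neg_natCast {ℓ n : ℕ} (hℓ : ℓ.Prime) (hn : n = 1 ∨ n.Prime) (hne : ℓ ≠ n) :
    ¬ (ℓ : ℤ) ∣ -(n : ℤ) := by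
  rw [Int.dvd_neg, Int.natCast_dvd_natCast]
  intro h
  rcases hn with rfl | hn
  · exact hℓ.one_lt.ne' (Nat.dvd_one.1 h)
  · exact hne ((Nat.prime_dvd_prime_iff_eq hℓ hn).1 h)

/-- **(A) BIQUADRATIC `E = F(√b₀)` (`θ = c₁²·b₀`, `b₀ ∈ ℤ`): `T(c)`, `c ∈ ℚ^×`, IS CONSTANT ON THE FIBRE OVER EVERY ODD
PRIME `ℓ ∤ b₀`** — for all places `v, v' ∋ ℓ` of `F`: `v ∈ T(c) ⟺ v' ∈ T(c)` (if `v ≠ v'`, both have `e = 1` and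
residue field `𝔽_ℓ`, in which `b₀` is a square or not simultaneously). [cite: Omeara1963, §63B Cor. 63:11a]
[cite: Deligne1982HodgeCycles, §4 (1)] -/
theorem inl_mem_badPlaces_ratCast_iff_of_intCast_radicand {p q : ℤ} (hR : R = X ^ 2 + C p * X + C q)
    {c₁ : realField R} {b₀ : ℤ}
    (hfac : AdjoinRoot.root (realPolyQ R) = c₁ ^ 2 * ((b₀ : 𝓞 (realField R)) : realField R))
    {ℓ : ℕ} (hℓ : ℓ.Prime) (hℓ2 : ℓ ≠ 2) (hℓb : ¬ (ℓ : ℤ) ∣ b₀) (v v' : HeightOneSpectrum (𝓞 (realField R)))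
    (hv : (ℓ : 𝓞 (realField R)) ∈ v.asIdeal) (hv' : (ℓ : 𝓞 (realField R)) ∈ v'.asIdeal) {c : ℚ} (hc : c ≠ 0) :
    Sum.inl v ∈ badPlaces (c : realField R) (AdjoinRoot.root (realPolyQ R)) ↔
      Sum.inl v' ∈ badPlaces (c : realField R) (AdjoinRoot.root (realPolyQ R)) := by
  by_cases hne : v = v'
  · subst hne; exact Iff.rfl
  haveI := liesOver_span_of_natCast_mem hℓ v hv
  haveI := liesOver_span_of_natCast_mem hℓ v' hv'
  have hK := finrank_realField_quadratic hR
  have he := ramificationIdx'_eq_one_of_ne hK hℓ v v' hne hv hv'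
  have he' := ramificationIdx'_eq_one_of_ne hK hℓ v' v (Ne.symm hne) hv' hv
  obtain ⟨-, hN⟩ := span_natCast_eq_mul_of_ne hK hℓ v v' hne hv hv'
  obtain ⟨-, hN'⟩ := span_natCast_eq_mul_of_ne hK hℓ v' v (Ne.symm hne) hv' hv
  have h2ℓ : ¬ (ℓ : ℤ) ∣ 2 := fun h ↦
    hℓ2 ((Nat.prime_dvd_prime_iff_eq hℓ Nat.prime_two).1 (by exact_mod_cast h))
  have h2 : (2 : 𝓞 (realField R)) ∉ v.asIdeal := by
    have h := (intCast_mem_iff_natCast_dvd hℓ v hv 2).not.2 h2ℓ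
    rwa [Int.cast_ofNat] at h
  have h2' : (2 : 𝓞 (realField R)) ∉ v'.asIdeal := by
    have h := (intCast_mem_iff_natCast_dvd hℓ v' hv' 2).not.2 h2ℓ
    rwa [Int.cast_ofNat] at h
  have hb : (b₀ : 𝓞 (realField R)) ∉ v.asIdeal := (intCast_mem_iff_natCast_dvd hℓ v hv b₀).not.2 hℓb
  have hb' : (b₀ : 𝓞 (realField R)) ∉ v'.asIdeal := (intCast_mem_iff_natCast_dvd hℓ v' hv' b₀).not.2 hℓb
  have hsymm : IsSquare (Ideal.Quotient.mk v.asIdeal (b₀ : 𝓞 (realField R))) ↔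
      IsSquare (Ideal.Quotient.mk v'.asIdeal (b₀ : 𝓞 (realField R))) := by
    rw [isSquare_intCast_residue_iff_of_absNorm_eq v hℓ hN, isSquare_intCast_residue_iff_of_absNorm_eq v' hℓ hN']
  exact inl_mem_badPlaces_ratCast_iff_of_liesOver_of_eq_sq_mul hfac hℓ v v' (he.trans he'.symm) h2 h2' hb hb'
    hsymm hc

/-- **(A), row form: a `|T| = 2` row `{v, w}` with `v` one of two places over an odd prime `ℓ ∤ b₀` and `w` NOT the
other one has NO RATIONAL MEMBER**: `T(c) ≠ {v, w}` for every `c ∈ ℚ^×` (biquadratic carriers). These are the «–» rows of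
§b03.5 / §b03.29 for the fifteen biquadratic quartic CM fields, now for every rational number.
[cite: Deligne1982HodgeCycles, §4 (1) and Cor. 4.2] -/
theorem badPlaces_ratCast_ne_pair_of_intCast_radicand {p q : ℤ} (hR : R = X ^ 2 + C p * X + C q)
    {c₁ : realField R} {b₀ : ℤ}
    (hfac : AdjoinRoot.root (realPolyQ R) = c₁ ^ 2 * ((b₀ : 𝓞 (realField R)) : realField R))
    {ℓ : ℕ} (hℓ : ℓ.Prime) (hℓ2 : ℓ ≠ 2) (hℓb : ¬ (ℓ : ℤ) ∣ b₀) (v v' w : HeightOneSpectrum (𝓞 (realField R)))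
    (hv : (ℓ : 𝓞 (realField R)) ∈ v.asIdeal) (hv' : (ℓ : 𝓞 (realField R)) ∈ v'.asIdeal) (hne : v ≠ v') (hw : w ≠ v')
    {c : ℚ} (hc : c ≠ 0) :
    badPlaces (c : realField R) (AdjoinRoot.root (realPolyQ R)) ≠ {Sum.inl v, Sum.inl w} := by
  intro h
  have h1 : Sum.inl v ∈ badPlaces (c : realField R) (AdjoinRoot.root (realPolyQ R)) := by
    rw [h]; exact Set.mem_insert _ _
  have h2 := (inl_mem_badPlaces_ratCast_iff_of_intCast_radicand hR hfac hℓ hℓ2 hℓb v v' hv hv' hc).1 h1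
  rw [h, Set.mem_insert_iff, Set.mem_singleton_iff] at h2
  rcases h2 with h2 | h2
  · exact hne (Sum.inl_injective h2).symm
  · exact hw (Sum.inl_injective h2).symm

omit [Fact (Irreducible (cmPolyQ R))] in
/-- **(B) `E/ℚ` CYCLIC (`q = θθ' = s₀²` in `𝓞_F`): `T(c)`, `c ∈ ℚ^×`, IS CONSTANT ON THE FIBRE OVER EVERY ODD PRIME
`ℓ ∤ q`** — for all places `v, v' ∋ ℓ`: `v ∈ T(c) ⟺ v' ∈ T(c)` (the residues of `θ` at two distinct places over `ℓ` are the
two roots of `R̄`, whose product `q̄` is a non-zero square). [cite: Omeara1963, §63B Cor. 63:11a]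
[cite: Deligne1982HodgeCycles, §4 (1)] -/
theorem inl_mem_badPlaces_ratCast_iff_of_sq_eq {p q : ℤ} (hR : R = X ^ 2 + C p * X + C q)
    {θₒ s₀ : 𝓞 (realField R)} (hθ : (θₒ : realField R) = AdjoinRoot.root (realPolyQ R)) (hs : s₀ ^ 2 = q)
    {ℓ : ℕ} (hℓ : ℓ.Prime) (hℓ2 : ℓ ≠ 2) (hℓq : ¬ (ℓ : ℤ) ∣ q) (v v' : HeightOneSpectrum (𝓞 (realField R)))
    (hv : (ℓ : 𝓞 (realField R)) ∈ v.asIdeal) (hv' : (ℓ : 𝓞 (realField R)) ∈ v'.asIdeal) {c : ℚ} (hc : c ≠ 0) :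
    Sum.inl v ∈ badPlaces (c : realField R) (AdjoinRoot.root (realPolyQ R)) ↔
      Sum.inl v' ∈ badPlaces (c : realField R) (AdjoinRoot.root (realPolyQ R)) := by
  by_cases hne : v = v'
  · subst hne; exact Iff.rfl
  haveI := liesOver_span_of_natCast_mem hℓ v hv
  haveI := liesOver_span_of_natCast_mem hℓ v' hv'
  have hK := finrank_realField_quadratic hR
  have he := ramificationIdx'_eq_one_of_ne hK hℓ v v' hne hv hv'
  have he' := ramificationIdx'_eq_one_of_ne hK hℓ v' v (Ne.symm hne) hv' hv
  obtain ⟨-, hN⟩ := span_natCast_eq_mul_of_ne hK hℓ v v' hne hv hv'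
  obtain ⟨-, hN'⟩ := span_natCast_eq_mul_of_ne hK hℓ v' v (Ne.symm hne) hv' hv
  have h2ℓ : ¬ (ℓ : ℤ) ∣ 2 := fun h ↦
    hℓ2 ((Nat.prime_dvd_prime_iff_eq hℓ Nat.prime_two).1 (by exact_mod_cast h))
  have h2 : (2 : 𝓞 (realField R)) ∉ v.asIdeal := by
    have h := (intCast_mem_iff_natCast_dvd hℓ v hv 2).not.2 h2ℓ
    rwa [Int.cast_ofNat] at h
  have h2' : (2 : 𝓞 (realField R)) ∉ v'.asIdeal := by
    have h := (intCast_mem_iff_natCast_dvd hℓ v' hv' 2).not.2 h2ℓ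
    rwa [Int.cast_ofNat] at h
  have hrel := ringOfIntegers_root_rel_quadratic hR hθ
  obtain ⟨θ', hθ'⟩ : ∃ θ' : 𝓞 (realField R), θ' = -(p : 𝓞 (realField R)) - θₒ := ⟨_, rfl⟩
  have hsum : θₒ + θ' = -p := by rw [hθ']; ring
  have hprod : θₒ * θ' = q := by rw [hθ']; linear_combination -hrel
  have hqv : (q : 𝓞 (realField R)) ∉ v.asIdeal := (intCast_mem_iff_natCast_dvd hℓ v hv q).not.2 hℓq
  have hqv' : (q : 𝓞 (realField R)) ∉ v'.asIdeal := (intCast_mem_iff_natCast_dvd hℓ v' hv' q).not.2 hℓq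
  have hθv : θₒ ∉ v.asIdeal := fun h ↦ hqv (by rw [← hprod]; exact v.asIdeal.mul_mem_right _ h)
  have hθv' : θₒ ∉ v'.asIdeal := fun h ↦ hqv' (by rw [← hprod]; exact v'.asIdeal.mul_mem_right _ h)
  have hsymm := isSquare_residue_iff_of_mul_eq_sq hsum hprod hs hℓ v v' hN hN' hv hv' hqv
  exact inl_mem_badPlaces_ratCast_iff_of_liesOver hθ hℓ v v' (he.trans he'.symm) h2 h2' hθv hθv' hsymm hc

omit [Fact (Irreducible (cmPolyQ R))] in
/-- **(B), row form: a `|T| = 2` row `{v, w}` with `v` one of two places over an odd prime `ℓ ∤ q` and `w` NOT the other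
one has NO RATIONAL MEMBER** (`E/ℚ` cyclic: `q = s₀²` in `𝓞_F`). The «–» rows of the five cyclic quartic CM-field
tables (`ℚ(ζ₅)`, `ℚ(√-(2+√2))`, conductors 40, 48, 60) for every rational number.
[cite: Deligne1982HodgeCycles, §4 (1) and Cor. 4.2] -/
theorem badPlaces_ratCast_ne_pair_of_sq_eq {p q : ℤ} (hR : R = X ^ 2 + C p * X + C q)
    {θₒ s₀ : 𝓞 (realField R)} (hθ : (θₒ : realField R) = AdjoinRoot.root (realPolyQ R)) (hs : s₀ ^ 2 = q)
    {ℓ : ℕ} (hℓ : ℓ.Prime) (hℓ2 : ℓ ≠ 2) (hℓq : ¬ (ℓ : ℤ) ∣ q) (v v' w : HeightOneSpectrum (𝓞 (realField R)))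
    (hv : (ℓ : 𝓞 (realField R)) ∈ v.asIdeal) (hv' : (ℓ : 𝓞 (realField R)) ∈ v'.asIdeal) (hne : v ≠ v') (hw : w ≠ v')
    {c : ℚ} (hc : c ≠ 0) :
    badPlaces (c : realField R) (AdjoinRoot.root (realPolyQ R)) ≠ {Sum.inl v, Sum.inl w} := by
  intro h
  have h1 : Sum.inl v ∈ badPlaces (c : realField R) (AdjoinRoot.root (realPolyQ R)) := by
    rw [h]; exact Set.mem_insert _ _
  have h2 := (inl_mem_badPlaces_ratCast_iff_of_sq_eq hR hθ hs hℓ hℓ2 hℓq v v' hv hv' hc).1 h1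
  rw [h, Set.mem_insert_iff, Set.mem_singleton_iff] at h2
  rcases h2 with h2 | h2
  · exact hne (Sum.inl_injective h2).symm
  · exact hw (Sum.inl_injective h2).symm

/-- **(C) AN ODD PRIME RAMIFIED IN `F`** (`(p, π)² = (p)`: `π² = p·w`, `ap + bw = 1`; `θ = c₁²·b₁` with `b₁` a unit at the
place): the place `v ∋ p` lies in NO `T(c)`, `c ∈ ℚ^×` (`e(v|p) = 2`, so `ord_v c` is even).
[cite: Omeara1963, §63B Cor. 63:11a and Example 63:12] -/
theorem inl_notMem_badPlaces_ratCast_of_sq_eq_mul {p₀ q₀ : ℤ} (hR : R = X ^ 2 + C p₀ * X + C q₀)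
    {c₁ : realField R} {b₁ : 𝓞 (realField R)} (hfac : AdjoinRoot.root (realPolyQ R) = c₁ ^ 2 * (b₁ : realField R))
    {p : ℕ} (hp : p.Prime) (hp2 : p ≠ 2) {π w a b : 𝓞 (realField R)} (hπ : π ^ 2 = p * w) (hab : a * p + b * w = 1)
    (v : HeightOneSpectrum (𝓞 (realField R))) (hv : (p : 𝓞 (realField R)) ∈ v.asIdeal) (hbv : b₁ ∉ v.asIdeal)
    {c : ℚ} (hc : c ≠ 0) :
    Sum.inl v ∉ badPlaces (c : realField R) (AdjoinRoot.root (realPolyQ R)) := by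
  haveI := liesOver_span_of_natCast_mem hp v hv
  have he := ramificationIdx'_eq_two_of_sq_eq_mul (finrank_realField_quadratic hR) hp hπ hab v hv
  have h2p : ¬ (p : ℤ) ∣ 2 := fun h ↦
    hp2 ((Nat.prime_dvd_prime_iff_eq hp Nat.prime_two).1 (by exact_mod_cast h))
  have h2 : (2 : 𝓞 (realField R)) ∉ v.asIdeal := by
    have h := (intCast_mem_iff_natCast_dvd hp v hv 2).not.2 h2p
    rwa [Int.cast_ofNat] at h
  exact inl_notMem_badPlaces_ratCast_of_even_ramificationIdx_of_eq_sq_mul hfac hp v (by rw [he]; exact even_two)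
    h2 hbv hc

/-- **(C), row form**: with `v` as in (C), `T(c) ≠ {v, w}` for every place `w` and every `c ∈ ℚ^×` — a `|T| = 2` row
through an odd prime ramified in `F` (and inert in `E`) has no rational member. [cite: Deligne1982HodgeCycles, §4 (1)] -/
theorem badPlaces_ratCast_ne_pair_of_sq_eq_mul {p₀ q₀ : ℤ} (hR : R = X ^ 2 + C p₀ * X + C q₀)
    {c₁ : realField R} {b₁ : 𝓞 (realField R)} (hfac : AdjoinRoot.root (realPolyQ R) = c₁ ^ 2 * (b₁ : realField R))
    {p : ℕ} (hp : p.Prime) (hp2 : p ≠ 2) {π w a b : 𝓞 (realField R)} (hπ : π ^ 2 = p * w) (hab : a * p + b * w = 1)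
    (v : HeightOneSpectrum (𝓞 (realField R))) (hv : (p : 𝓞 (realField R)) ∈ v.asIdeal) (hbv : b₁ ∉ v.asIdeal)
    (w' : HeightOneSpectrum (𝓞 (realField R))) {c : ℚ} (hc : c ≠ 0) :
    badPlaces (c : realField R) (AdjoinRoot.root (realPolyQ R)) ≠ {Sum.inl v, Sum.inl w'} := by
  intro h
  have h1 : Sum.inl v ∈ badPlaces (c : realField R) (AdjoinRoot.root (realPolyQ R)) := by
    rw [h]; exact Set.mem_insert _ _
  exact inl_notMem_badPlaces_ratCast_of_sq_eq_mul hR hfac hp hp2 hπ hab v hv hbv hc h1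

end Summit.HodgeConjecture.HodgeConjecture.Ring2.WeilCoverageCM

end
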